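import Summits.ABC.ABC.Theses.CubicResolventAllowance
import Literature.NumberTheory.DiophantineGeometry.FaltingsHeightProofs
import Literature.NumberTheory.DiophantineGeometry.FaltingsHeightJInvariantExplicit
import Literature.NumberTheory.EllipticCurves.BSDInvariants
import Literature.NumberTheory.EllipticCurves.BSDQuadraticDescentPeriodEliminationProofs
import Literature.NumberTheory.EllipticCurves.GlobalMinimalModelProofs
import Literature.NumberTheory.EllipticCurves.SzpiroOfAbcProofs
import Literature.NumberTheory.DiophantineGeometry.MinimalDiscriminantProofs
import HarnessLib

/-!
# STUB-IDEAS `stub_realCubic` · ideator k2 (FAMILY 2 — RESHAPE) · generation 13 —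
# the BSD / Goldfeld–Szpiro side of the stub, typed: the reformulation lands on the
# FALTINGS-HEIGHT kernel (provably ⇒ stub, and strictly STRONGER: it carries `c₄³` too),
# and the twist-range ladder `κ = 6 + 12A` (GS95: κ = 18) whose rung `A = 0` is the stub.

Crux stmt-ABC-22740 `CubicResolventAllowance.IndexSzpiro`, stub `stub_realCubic` (the `0 < d_K` half).
Typed here (sorries ONLY in §4 `c4Allowance_of_heightAllowance` (M, strength flag) — everything the
assembly uses is PROVED):
* §0 `StubRealCubic` (verbatim) and its exponent-parametrised form `StubRealCubicExp κ` (`κ = 6` is the stub, `Iff.rfl`).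
* §1 H1 `HeightAllowanceExp κ` : `12·h(E) ≤ C + log|d_K| + (κ+ε)·log N` on the class;
  H2 `stubExp_of_heightAllowanceExp : HeightAllowanceExp κ → StubRealCubicExp κ` (PROVED, from the tree's
  Pasten/Silverman comparison `log Δ_min < 12h + 16`).
* §2 the BSD side on the REAL class: H3a `complexPeriod_eq_of_Δ_pos` : `∫|ω∧ω̄| = Ω⁺·Ω⁻/2` (two real
  components), H3b `twelve_faltingsHeight_eq` : `12 h(E) = −6·log(Ω⁺Ω⁻/4)` for a global minimal model,
  H3c `PeriodProductBound κ` (`(Ω⁺Ω⁻/4)⁻⁶ ≤ C·|d_K|·N^{κ+ε}`) and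
  H3d `heightAllowanceExp_of_periodProductBound : SignDictionary → PeriodProductBound κ → HeightAllowanceExp κ`
  (PROVED; `SignDictionary` = "real resolvent field ⇒ Δ > 0", on the k1 pages).
* §3 the GS ladder: H4a `RealPeriodLowerBound β` (`Ω⁺(E), Ω⁻(E) ≥ C⁻¹·N^{−β−ε}` on minimal models of the
  class — what BSD(rank-0 twists `|d| ≤ N^A`) + `Ш(E_d) ≪ N_d^{1/2+ε}` + a short-twist non-vanishing give with
  `β = 1/2 + A`), H4b `periodProductBound_of_realPeriodLowerBound : RealPeriodLowerBound β → PeriodProductBound (12β)`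
  (PROVED; note `d_K` is pure slack on this side), H4c `gsQuotient` + `bsd_period_identity` (PROVED: how `Ω`
  enters LEAD).
* §4 H5 `C4AllowanceExp κ` + `c4Allowance_of_heightAllowance` (sorry, M): the height kernel also bounds
  `|c₄(E_min)|³` — i.e. it is GENERALISED Szpiro on the class (abc-strength), strictly above the stub.
Verdict on the stub: unchanged (open-problem). Under BSD the reformulation is an EQUIVALENCE
(de Weger 1998 p.109 citing GS95): it trades Szpiro-on-the-class for GS-on-the-class, no rung `κ < ∞` is
unconditional.
-/

namespace Summit.ABC.ABC.Cruxes.IndexSzpiro.StubIdeas2RealG13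

open Summit.ABC.ABC.Theses.CubicResolventAllowance
open Polynomial

/-! ## §0 The stub (verbatim) and its exponent-parametrised form -/

/-- The registered stub `stub_realCubic`, verbatim. -/
def StubRealCubic : Prop :=
  ∀ ε : ℝ, 0 < ε → ∃ C : ℝ, ∀ (W : WeierstrassCurve ℚ) [W.IsElliptic] (K : Type) [Field K] [NumberField K],
    Irreducible W.twoTorsionPolynomial.toPoly → Module.finrank ℚ K = 3 →
    (∃ θ : K, aeval θ W.twoTorsionPolynomial.toPoly = 0) → 0 < NumberField.discr K →
    (W.minimalDiscriminantNorm ℤ : ℝ) ≤ C * |(NumberField.discr K : ℝ)| * (W.conductorNorm ℤ : ℝ) ^ (6 + ε)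

/-- The stub with Szpiro exponent `κ` in place of `6` (the GS ladder runs in `κ`). -/
def StubRealCubicExp (κ : ℝ) : Prop :=
  ∀ ε : ℝ, 0 < ε → ∃ C : ℝ, ∀ (W : WeierstrassCurve ℚ) [W.IsElliptic] (K : Type) [Field K] [NumberField K],
    Irreducible W.twoTorsionPolynomial.toPoly → Module.finrank ℚ K = 3 →
    (∃ θ : K, aeval θ W.twoTorsionPolynomial.toPoly = 0) → 0 < NumberField.discr K →
    (W.minimalDiscriminantNorm ℤ : ℝ) ≤ C * |(NumberField.discr K : ℝ)| * (W.conductorNorm ℤ : ℝ) ^ (κ + ε)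

/-- `κ = 6` is the stub. -/
theorem stubRealCubicExp_six : StubRealCubicExp 6 ↔ StubRealCubic := Iff.rfl

/-! ## §1 T1 — the Faltings-height kernel (what the BSD side actually sees) -/

/-- **H1 `HeightAllowanceExp κ`.** On the real class: `12·h(E/ℚ) ≤ C(ε) + log|d_K| + (κ+ε)·log N_E`
(`h` = the tree's `WeierstrassCurve.faltingsHeight`, model independent). `κ = 6` is the kernel the
BSD/GS reformulation targets. STRONGER than the stub (§4). -/
def HeightAllowanceExp (κ : ℝ) : Prop :=
  ∀ ε : ℝ, 0 < ε → ∃ C : ℝ, ∀ (W : WeierstrassCurve ℚ) [W.IsElliptic] (K : Type) [Field K] [NumberField K],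
    Irreducible W.twoTorsionPolynomial.toPoly → Module.finrank ℚ K = 3 →
    (∃ θ : K, aeval θ W.twoTorsionPolynomial.toPoly = 0) → 0 < NumberField.discr K →
    12 * W.faltingsHeight ≤
      C + Real.log |(NumberField.discr K : ℝ)| + (κ + ε) * Real.log (W.conductorNorm ℤ : ℝ)

/-- The height kernel at the stub's exponent. -/
def HeightAllowance : Prop := HeightAllowanceExp 6

/-- **H2 (PROVED).** `HeightAllowanceExp κ → StubRealCubicExp κ`: exponentiate
`log Δ_min < 12h + 16` (tree: `log_minimalDiscriminantNorm_lt_faltingsHeight_holds`, Pasten 2024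
Lemma 18.1) with `C' = e^{C+16}`. -/
theorem stubExp_of_heightAllowanceExp (κ : ℝ) : HeightAllowanceExp κ → StubRealCubicExp κ := by
  intro h ε hε
  obtain ⟨C, hC⟩ := h ε hε
  refine ⟨Real.exp (C + 16), ?_⟩
  intro W _ K _ _ hirr hdeg hθ hd
  have hH := hC W K hirr hdeg hθ hd
  have hS := WeierstrassCurve.log_minimalDiscriminantNorm_lt_faltingsHeight_holds W
  rw [WeierstrassCurve.minimalDiscriminantNorm_ringOfIntegers_rat_holds W, Module.finrank_self,
    Nat.cast_one, inv_one, one_mul] at hS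
  have hΔpos : (0 : ℝ) < (W.minimalDiscriminantNorm ℤ : ℝ) := by
    exact_mod_cast W.minimalDiscriminantNorm_pos_holds
  have hNpos : (0 : ℝ) < (W.conductorNorm ℤ : ℝ) := by exact_mod_cast W.conductorNorm_pos_holds
  have hdpos : (0 : ℝ) < |(NumberField.discr K : ℝ)| :=
    abs_pos.mpr (by exact_mod_cast NumberField.discr_ne_zero K)
  have h1 : Real.exp (C + 16) ≠ 0 := (Real.exp_pos _).ne'
  have h2 : |(NumberField.discr K : ℝ)| ≠ 0 := hdpos.ne'
  have h3 : (W.conductorNorm ℤ : ℝ) ^ (κ + ε) ≠ 0 := (Real.rpow_pos_of_pos hNpos _).ne'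
  have hR : 0 < Real.exp (C + 16) * |(NumberField.discr K : ℝ)| * (W.conductorNorm ℤ : ℝ) ^ (κ + ε) :=
    mul_pos (mul_pos (Real.exp_pos _) hdpos) (Real.rpow_pos_of_pos hNpos _)
  have key : Real.log (W.minimalDiscriminantNorm ℤ : ℝ) ≤
      Real.log (Real.exp (C + 16) * |(NumberField.discr K : ℝ)| * (W.conductorNorm ℤ : ℝ) ^ (κ + ε)) := by
    rw [Real.log_mul (mul_ne_zero h1 h2) h3, Real.log_mul h1 h2, Real.log_exp, Real.log_rpow hNpos]
    linarith
  exact (Real.log_le_log_iff hΔpos hR).mp key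

/-- H2 at the stub's exponent. -/
theorem stub_of_heightAllowance : HeightAllowance → StubRealCubic :=
  fun h => (stubRealCubicExp_six).mp (stubExp_of_heightAllowanceExp 6 h)

/-! ## §2 T1 — the BSD side: on the real class `12 h(E) = −6 log(Ω⁺Ω⁻/4)` -/

/-- Base change `ℚ → ℝ → ℂ` is base change `ℚ → ℂ` (the tree's private lemma, re-proved). -/
theorem baseChange_real_map_complex (W : WeierstrassCurve ℚ) :
    (W.baseChange ℝ).map (algebraMap ℝ ℂ) = W.baseChange ℂ := by
  rw [WeierstrassCurve.baseChange, WeierstrassCurve.baseChange, WeierstrassCurve.map_map]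
  congr 1

/-- The **minus period** `Ω⁻(W) = Ω(W^{(−1)})`: the real period of the twist by `−1` of the real model
(for a rectangular lattice — the real class — this is the imaginary period up to the factor 2). -/
noncomputable def minusPeriod (W : WeierstrassCurve ℚ) : ℝ :=
  ((W.baseChange ℝ).quadraticTwist (-1)).realPeriod

/-- `Ω⁻ > 0`. -/
theorem minusPeriod_pos (W : WeierstrassCurve ℚ) [W.IsElliptic] : 0 < minusPeriod W := by
  haveI : (W.baseChange ℝ).IsElliptic := by rw [WeierstrassCurve.baseChange]; infer_instance
  haveI : ((W.baseChange ℝ).quadraticTwist (-1)).IsElliptic :=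
    (W.baseChange ℝ).isElliptic_quadraticTwist (by norm_num)
  exact WeierstrassCurve.realPeriod_pos' _

/-- `Ω⁺ > 0`. -/
theorem realPeriodRat_pos'' (W : WeierstrassCurve ℚ) [W.IsElliptic] : 0 < W.realPeriodRat := by
  haveI : (W.baseChange ℝ).IsElliptic := by rw [WeierstrassCurve.baseChange]; infer_instance
  rw [WeierstrassCurve.realPeriodRat_def]
  exact WeierstrassCurve.realPeriod_pos' _

/-- **H3a (PROVED).** On the real class (`Δ > 0`, two real components):
`∫_{E(ℂ)}|ω∧ω̄| = Ω⁺·Ω⁻/2` (tree: `realPeriod_mul_realPeriod_quadraticTwist_mul_sqrt` at `D = −1`). -/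
theorem complexPeriod_eq_of_Δ_pos (W : WeierstrassCurve ℚ) [W.IsElliptic] (hΔ : 0 < W.Δ) :
    (W.baseChange ℂ).complexPeriod = W.realPeriodRat * minusPeriod W / 2 := by
  haveI : (W.baseChange ℝ).IsElliptic := by rw [WeierstrassCurve.baseChange]; infer_instance
  have hΔR : 0 < (W.baseChange ℝ).Δ := by
    have : (W.baseChange ℝ).Δ = (W.Δ : ℝ) := by
      simp [WeierstrassCurve.baseChange, WeierstrassCurve.map_Δ]
    rw [this]; exact_mod_cast hΔ
  have h := (W.baseChange ℝ).realPeriod_mul_realPeriod_quadraticTwist_mul_sqrt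
    (D := -1) (by norm_num)
  rw [neg_neg, Real.sqrt_one, mul_one, baseChange_real_map_complex,
    (W.baseChange ℝ).numRealComponents_of_Δ_pos hΔR] at h
  rw [WeierstrassCurve.realPeriodRat_def, minusPeriod]
  push_cast at h
  linarith

/-- **H3b (PROVED).** For a GLOBAL MINIMAL model on the real class:
`12·h(E) = −6·log(Ω⁺Ω⁻/4)` (tree: `faltingsHeight_eq_neg_half_log`, Pasten 2024 §3, + H3a). This is the
whole BSD↔Szpiro dictionary: LEAD sees `Ω⁺` (and `Ω⁻` through `E^{(−1)}`), i.e. exactly `h(E)`. -/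
theorem twelve_faltingsHeight_eq (W : WeierstrassCurve ℚ) [W.IsElliptic] [W.IsGloballyMinimal]
    (hΔ : 0 < W.Δ) :
    12 * W.faltingsHeight = -6 * Real.log (W.realPeriodRat * minusPeriod W / 4) := by
  rw [W.faltingsHeight_eq_neg_half_log, complexPeriod_eq_of_Δ_pos W hΔ,
    show W.realPeriodRat * minusPeriod W / 2 / 2 = W.realPeriodRat * minusPeriod W / 4 by ring]
  ring

/-- **`SignDictionary`** (k1 pages, g8 §sign; Cremona §3.7): on the class, a REAL cubic resolvent field
forces `Δ(W) > 0` (`d_K` and `disc(ψ₂) = 16Δ` have the same sign). Hypothesis Prop here. -/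
def SignDictionary : Prop :=
  ∀ (W : WeierstrassCurve ℚ) [W.IsElliptic] (K : Type) [Field K] [NumberField K],
    Irreducible W.twoTorsionPolynomial.toPoly → Module.finrank ℚ K = 3 →
    (∃ θ : K, aeval θ W.twoTorsionPolynomial.toPoly = 0) → 0 < NumberField.discr K → 0 < W.Δ

/-- **H3c `PeriodProductBound κ`** — the stub READ ON THE BSD SIDE: for `(W, K)` in the real class and any
global minimal model `C₀ • W` of it, `(Ω⁺Ω⁻/4)⁻⁶ ≤ C(ε)·|d_K|·N^{κ+ε}`. -/
def PeriodProductBound (κ : ℝ) : Prop :=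
  ∀ ε : ℝ, 0 < ε → ∃ C : ℝ, ∀ (W : WeierstrassCurve ℚ) [W.IsElliptic] (K : Type) [Field K] [NumberField K],
    Irreducible W.twoTorsionPolynomial.toPoly → Module.finrank ℚ K = 3 →
    (∃ θ : K, aeval θ W.twoTorsionPolynomial.toPoly = 0) → 0 < NumberField.discr K →
    ∀ (C₀ : WeierstrassCurve.VariableChange ℚ) [(C₀ • W).IsGloballyMinimal],
      ((C₀ • W).realPeriodRat * minusPeriod (C₀ • W) / 4)⁻¹ ^ (6 : ℕ) ≤
        C * |(NumberField.discr K : ℝ)| * (W.conductorNorm ℤ : ℝ) ^ (κ + ε)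

/-- **H3d (PROVED).** `SignDictionary → PeriodProductBound κ → HeightAllowanceExp κ`
(Néron minimal model `hasGlobalMinimalModel_rat_holds`, `faltingsHeight_smul`, H3b, logarithms). -/
theorem heightAllowanceExp_of_periodProductBound (κ : ℝ) (hsgn : SignDictionary) :
    PeriodProductBound κ → HeightAllowanceExp κ := by
  intro h ε hε
  obtain ⟨C, hC⟩ := h ε hε
  refine ⟨Real.log (max C 1), ?_⟩
  intro W _ K _ _ hirr hdeg hθ hd
  have hΔ : 0 < W.Δ := hsgn W K hirr hdeg hθ hd
  obtain ⟨C₀, hC₀⟩ := WeierstrassCurve.hasGlobalMinimalModel_rat_holds W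
  haveI := hC₀
  have hΔ' : 0 < (C₀ • W).Δ := by
    rw [WeierstrassCurve.variableChange_Δ]
    exact mul_pos (Even.pow_pos (by decide) (Units.ne_zero _)) hΔ
  have hB := hC W K hirr hdeg hθ hd C₀
  have hNpos : (0 : ℝ) < (W.conductorNorm ℤ : ℝ) := by exact_mod_cast W.conductorNorm_pos_holds
  have hdpos : (0 : ℝ) < |(NumberField.discr K : ℝ)| :=
    abs_pos.mpr (by exact_mod_cast NumberField.discr_ne_zero K)
  set x : ℝ := (C₀ • W).realPeriodRat * minusPeriod (C₀ • W) / 4 with hx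
  have hxpos : 0 < x := by
    have h1 := realPeriodRat_pos'' (C₀ • W)
    have h2 := minusPeriod_pos (C₀ • W)
    positivity
  have hheight : 12 * W.faltingsHeight = -6 * Real.log x := by
    rw [← WeierstrassCurve.faltingsHeight_smul W C₀]
    exact twelve_faltingsHeight_eq (C₀ • W) hΔ'
  have hM : 0 < max C 1 := lt_max_of_lt_right one_pos
  have hB' : x⁻¹ ^ (6 : ℕ) ≤ max C 1 * |(NumberField.discr K : ℝ)| * (W.conductorNorm ℤ : ℝ) ^ (κ + ε) :=
    hB.trans (mul_le_mul_of_nonneg_right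
      (mul_le_mul_of_nonneg_right (le_max_left C 1) (abs_nonneg _)) (Real.rpow_nonneg hNpos.le _))
  have h1 : (max C 1 : ℝ) ≠ 0 := hM.ne'
  have h2 : |(NumberField.discr K : ℝ)| ≠ 0 := hdpos.ne'
  have h3 : (W.conductorNorm ℤ : ℝ) ^ (κ + ε) ≠ 0 := (Real.rpow_pos_of_pos hNpos _).ne'
  have hlog := Real.log_le_log (by positivity) hB'
  rw [Real.log_pow, Real.log_inv, Real.log_mul (mul_ne_zero h1 h2) h3, Real.log_mul h1 h2,
    Real.log_rpow hNpos] at hlog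
  rw [hheight]
  push_cast at hlog
  linarith

/-- The BSD-side assembly at the stub's exponent: `SignDictionary → PeriodProductBound 6 → stub`. -/
theorem stub_of_periodProductBound (hsgn : SignDictionary) (h : PeriodProductBound 6) : StubRealCubic :=
  stub_of_heightAllowance (heightAllowanceExp_of_periodProductBound 6 hsgn h)

/-! ## §3 T2 — the Goldfeld–Szpiro ladder (WEAKEN-AND-BOOTSTRAP on the twist range `A`) -/

/-- **H4a `RealPeriodLowerBound β`** — the output shape of the GS mechanism on the real class:
`Ω⁺(E) ≥ C(ε)⁻¹·N^{−β−ε}` and `Ω⁻(E) ≥ C(ε)⁻¹·N^{−β−ε}` for global minimal models. GS95 (BSD for the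
rank-0 twists `E_d`, `|d| ≤ N^A`, a twist with `L(E_d,1) ≫ N^{−ε}` from a first moment, and the HYPOTHESIS
`|Ш(E_d)| ≪ N_d^{1/2+ε}`, `N_d ∣ N d²`) gives `β = 1/2 + A`; note `d_K` never appears. -/
def RealPeriodLowerBound (β : ℝ) : Prop :=
  ∀ ε : ℝ, 0 < ε → ∃ C : ℝ, 0 < C ∧ ∀ (W : WeierstrassCurve ℚ) [W.IsElliptic] [W.IsGloballyMinimal],
    Irreducible W.twoTorsionPolynomial.toPoly → 0 < W.Δ →
    C⁻¹ * (W.conductorNorm ℤ : ℝ) ^ (-(β + ε)) ≤ W.realPeriodRat ∧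
      C⁻¹ * (W.conductorNorm ℤ : ℝ) ^ (-(β + ε)) ≤ minusPeriod W

/-- Irreducibility and the conductor are model invariants (bookkeeping used by H4b). The conductor half is
the tree's `conductorNorm_smul_rat`; the `ψ₂` half (roots move by `x ↦ u²x + r`) is a hypothesis Prop. -/
def IrreducibleSmulInvariant : Prop :=
  ∀ (W : WeierstrassCurve ℚ) (C₀ : WeierstrassCurve.VariableChange ℚ),
    Irreducible W.twoTorsionPolynomial.toPoly → Irreducible (C₀ • W).twoTorsionPolynomial.toPoly

/-- **H4b (PROVED).** `RealPeriodLowerBound β → PeriodProductBound (12β)`: `(Ω⁺Ω⁻/4)⁻⁶ ≤ 4⁶C¹²·N^{12β+12ε}`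
and `|d_K| ≥ 1` — the allowance is pure slack on the BSD side. With `β = 1/2 + A`: `κ = 6 + 12A`
(GS95's `18` is `A = 1`; the stub is `A = 0`). -/
theorem periodProductBound_of_realPeriodLowerBound (β : ℝ) (hinv : IrreducibleSmulInvariant)
    (hsgn : SignDictionary) :
    RealPeriodLowerBound β → PeriodProductBound (12 * β) := by
  intro h ε hε
  have hε' : 0 < ε / 12 := by positivity
  obtain ⟨C, hCpos, hC⟩ := h (ε / 12) hε'
  refine ⟨(4 : ℝ) ^ (6 : ℕ) * C ^ (12 : ℕ), ?_⟩
  intro W _ K _ _ hirr hdeg hθ hd C₀ _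
  have hΔ : 0 < W.Δ := hsgn W K hirr hdeg hθ hd
  have hΔ' : 0 < (C₀ • W).Δ := by
    rw [WeierstrassCurve.variableChange_Δ]
    exact mul_pos (Even.pow_pos (by decide) (Units.ne_zero _)) hΔ
  have hNeq : (C₀ • W).conductorNorm ℤ = W.conductorNorm ℤ := WeierstrassCurve.conductorNorm_smul_rat W C₀
  obtain ⟨hP, hM⟩ := hC (C₀ • W) (hinv W C₀ hirr) hΔ'
  rw [hNeq] at hP hM
  have hNpos : (0 : ℝ) < (W.conductorNorm ℤ : ℝ) := by exact_mod_cast W.conductorNorm_pos_holds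
  have hd1 : (1 : ℝ) ≤ |(NumberField.discr K : ℝ)| := by
    rw [← Int.cast_abs]; exact_mod_cast Int.one_le_abs (NumberField.discr_ne_zero K)
  set N : ℝ := (W.conductorNorm ℤ : ℝ) with hN
  set y : ℝ := C⁻¹ * N ^ (-(β + ε / 12)) with hy
  have hypos : 0 < y := by positivity
  have h1 := realPeriodRat_pos'' (C₀ • W)
  have h2 := minusPeriod_pos (C₀ • W)
  -- (Ω⁺Ω⁻/4)⁻¹ ≤ 4 / y²
  have hprod : y * y ≤ (C₀ • W).realPeriodRat * minusPeriod (C₀ • W) :=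
    mul_le_mul hP hM hypos.le h1.le
  have hinvle : ((C₀ • W).realPeriodRat * minusPeriod (C₀ • W) / 4)⁻¹ ≤ 4 * (y * y)⁻¹ := by
    rw [inv_div, div_eq_mul_inv]
    exact mul_le_mul_of_nonneg_left ((inv_le_inv₀ (by positivity) (by positivity)).mpr hprod) (by norm_num)
  have hpow : ((C₀ • W).realPeriodRat * minusPeriod (C₀ • W) / 4)⁻¹ ^ (6 : ℕ) ≤ (4 * (y * y)⁻¹) ^ (6 : ℕ) :=
    pow_le_pow_left₀ (by positivity) hinvle 6
  -- (4/y²)⁶ = 4⁶ C¹² N^{12β+ε}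
  have hyinv : y⁻¹ = C * N ^ (β + ε / 12) := by
    rw [hy, mul_inv, inv_inv, Real.rpow_neg hNpos.le, inv_inv]
  have hyy : (4 * (y * y)⁻¹) ^ (6 : ℕ) = (4 : ℝ) ^ (6 : ℕ) * C ^ (12 : ℕ) * N ^ (12 * β + ε) := by
    have e1 : (4 * (y * y)⁻¹) ^ (6 : ℕ) = (4 : ℝ) ^ (6 : ℕ) * (y⁻¹) ^ (12 : ℕ) := by ring
    have e2 : (N ^ (β + ε / 12)) ^ (12 : ℕ) = N ^ (12 * β + ε) := by
      rw [← Real.rpow_natCast, ← Real.rpow_mul hNpos.le]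
      congr 1
      push_cast
      ring
    rw [e1, hyinv, mul_pow, e2, mul_assoc]
  rw [hyy] at hpow
  calc ((C₀ • W).realPeriodRat * minusPeriod (C₀ • W) / 4)⁻¹ ^ (6 : ℕ)
      ≤ (4 : ℝ) ^ (6 : ℕ) * C ^ (12 : ℕ) * N ^ (12 * β + ε) := hpow
    _ = (4 : ℝ) ^ (6 : ℕ) * C ^ (12 : ℕ) * 1 * N ^ (12 * β + ε) := by ring
    _ ≤ (4 : ℝ) ^ (6 : ℕ) * C ^ (12 : ℕ) * |(NumberField.discr K : ℝ)| * N ^ (12 * β + ε) := by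
        gcongr

/-- **The rung the stub needs: `β = 1/2`**, i.e. twist range `A = 0` — an individual lower bound
`Ω^±(E) ≫ N^{−1/2−ε}` (equivalently, under LEAD for rank-0 short twists, `Ш·Tam ≪ N^{1/2+ε}`: the GS
conjecture itself on the class). -/
theorem stub_of_realPeriodLowerBound_half (hinv : IrreducibleSmulInvariant) (hsgn : SignDictionary)
    (h : RealPeriodLowerBound (1 / 2)) : StubRealCubic := by
  have h6 : PeriodProductBound (12 * (1 / 2)) := periodProductBound_of_realPeriodLowerBound _ hinv hsgn h
  norm_num at h6
  exact stub_of_periodProductBound hsgn h6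

/-- **GS95's rung in this currency: `β = 3/2` (`A = 1`, first-moment twist range `|d| ≍ N^{1+ε}`) gives
Szpiro exponent `18` on the class** (Goldfeld–Szpiro 1995, as reported in arXiv:1203.3865 p. 8). -/
theorem stubExp_eighteen_of_realPeriodLowerBound (hinv : IrreducibleSmulInvariant) (hsgn : SignDictionary)
    (h : RealPeriodLowerBound (3 / 2)) : StubRealCubicExp 18 := by
  have h18 : PeriodProductBound (12 * (3 / 2)) := periodProductBound_of_realPeriodLowerBound _ hinv hsgn h
  norm_num at h18
  exact stubExp_of_heightAllowanceExp 18 (heightAllowanceExp_of_periodProductBound 18 hsgn h18)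

/-! ### How `Ω` enters LEAD (the dictionary behind H4a) -/

/-- The **GS quotient** `#Ш·Reg·∏c_p/#T²` of a model over `ℚ` (for rank 0: `Reg = 1`). -/
noncomputable def gsQuotient (W : WeierstrassCurve ℚ) : ℝ :=
  (W.shaOrder : ℝ) * W.regulator * (W.tamagawaProduct : ℝ) / (W.torsionOrder : ℝ) ^ 2

/-- **H4c (PROVED).** LEAD reads `L^{(r)}(E,1)/r! = gsQuotient · Ω⁺`: the BSD side sees the curve ONLY through
`Ω⁺` (and `Ω⁻` via `E^{(−1)}`), hence through `h(E)` (H3b) — the source of the strength flag §4. -/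
theorem bsd_period_identity (W : WeierstrassCurve ℚ) (h : W.BSDLeadingTermFormula) :
    W.leadingLCoeff = ((gsQuotient W * W.realPeriodRat : ℝ) : ℂ) := by
  rw [h, WeierstrassCurve.bsdRHS, gsQuotient]
  push_cast
  ring

/-! ## §4 Strength flag: the height kernel is GENERALISED Szpiro on the class -/

/-- **H5 `C4AllowanceExp κ`**: `|c₄(E_min)|³ ≤ C·|d_K|·N^{κ+ε}` on the real class (global minimal models).
Together with the stub this is `max(|Δ_min|, |c₄|³) ≪ d_K·N^{κ+ε}` — generalised Szpiro with allowance. -/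
def C4AllowanceExp (κ : ℝ) : Prop :=
  ∀ ε : ℝ, 0 < ε → ∃ C : ℝ, ∀ (W : WeierstrassCurve ℚ) [W.IsElliptic] (K : Type) [Field K] [NumberField K],
    Irreducible W.twoTorsionPolynomial.toPoly → Module.finrank ℚ K = 3 →
    (∃ θ : K, aeval θ W.twoTorsionPolynomial.toPoly = 0) → 0 < NumberField.discr K →
    ∀ (C₀ : WeierstrassCurve.VariableChange ℚ) [(C₀ • W).IsGloballyMinimal],
      |((C₀ • W).c₄ : ℝ)| ^ (3 : ℕ) ≤ C * |(NumberField.discr K : ℝ)| * (W.conductorNorm ℤ : ℝ) ^ (κ + ε)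

/-- **H5 (M, sorry — STRENGTH FLAG, not for staffing).** `HeightAllowanceExp κ → C4AllowanceExp κ`:
for a minimal model `12h = log Δ_min − archTerm` (`faltingsHeight_rat`) and Silverman's upper inequality
`log⁺|j| + archTerm ≤ 6·log(1 + log⁺|j|) + 37` (tree: `log_max_j_add_faltingsArchTerm_le`) give
`12h ≥ log|c₄³| − 6·log(1 + log⁺|j|) − 37`; the `log log` is absorbed by `ε` using `|j| ≤ |c₄|³`
(`Δ_min ≥ 1`). So any proof of the stub THROUGH `h(E)` proves generalised Szpiro on the class. -/
theorem c4Allowance_of_heightAllowance (κ : ℝ) : HeightAllowanceExp κ → C4AllowanceExp κ := by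
  sorry

end Summit.ABC.ABC.Cruxes.IndexSzpiro.StubIdeas2RealG13
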